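import Literature.NumberTheory.LFunctions.RobinLcmPowerCriterion
import Literature.NumberTheory.LFunctions.LagariasCriterion
import HarnessLib

/-!
# The `κ`-Lagarias criterion (Fan–Kobayashi–Molnar 2026, §7): the `¬RH` half

Topic: `Literature/NumberTheory/LFunctions`. Second file on top of `RobinLcmPowerCriterion.lean`
(FKM Definition 2 `sigmaLcmPow κ = σ^[κ]`, `zetaRealSum κ = ζ(κ)` for real `κ > 1`, Theorem 5.2
`FanKobayashiMolnar2026_thm52`) and `LagariasCriterion.lean` (Lagarias 2002, Lemma 3.2
`Lagarias2002_lemma_3_2`, PROVED there).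

## Contents (as printed, FKM §7, p. 24 of the arXiv text)

*Lagarias' Lemma* (FKM Lemma 20 = Lagarias 2002, Lemmas 3.1–3.2): for `n ≥ 20`,
`e^γ n log log n + H_n ≤ H_n + e^{H_n} log H_n ≤ e^γ n log log n + 7n / log n`,
`H_n = ∑_{m ≤ n} 1/m`.

**Theorem 7.1.** Let `κ ≥ 2`. The following are equivalent: (1) the Riemann hypothesis;
(2) for `n > 55440`, `σ^[κ](n) < (e^{H_n} log H_n)^κ / ζ(κ)`; (3) for `n > 55440`,
`σ^[κ](n) < (H_n + e^{H_n} log H_n)^κ / ζ(κ)`. (Theorem 1.4, the "`κ`-Lagarias criterion", is the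
form `κ ≥ 4`, all `n > 1`.)

This file proves the RH-free implications **(3) ⇒ (1)** and **(2) ⇒ (1)** for EVERY real `κ > 1`
and any eventual range, following the printed proof (p. 24): if RH fails, Robin's theorem in the
form of Theorem 5.2 gives `σ^[κ](n) > (e^γ n log log n)^κ ζ(κ)⁻¹ (1 + c/(log n)^b)^κ` infinitely
often, while Lagarias' upper bound gives `H_n + e^{H_n} log H_n ≤ e^γ n log log n (1 + 7/(e^γ
log n log log n))`, and `7/(e^γ log n log log n) < c/(log n)^b` for all large `n` (`b < 1/2`).

* `harmonic_add_exp_mul_log_lt_eventually` : the comparison step;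
* `FanKobayashiMolnar2026_thm71_rh_of_eventually` : (3) for all sufficiently large `n` ⇒ RH;
* `FanKobayashiMolnar2026_thm71_rh_of_eventually_exp` : (2) for all sufficiently large `n` ⇒ RH;
* threshold forms `…_rh_of_forall_gt` / `…_rh_of_forall_gt_exp` (any `n₀`; the paper's
  `n₀ = 55440`, and `n₀ = 1` is the range of Theorem 1.4);
* `lagariasInequality_of_sigmaLcmPow_lt` : at a fixed `n ≥ 1`, the `κ`-Lagarias inequality implies
  Lagarias's inequality `σ(n) < H_n + e^{H_n} log H_n` (Lemma 17, as for Robin).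

## Not here

(1) ⇒ (2) (the paper's route: the effective Ramanujan theorem, Theorem 6.2, via `κ`-colossally
abundant numbers — not in the tree), the 33 resp. 25 exceptions below `55440` for `κ = 2`
(Remark 9). Printed-text note: in the arXiv text the two displays of Lagarias's inequality in
§1 (before and inside Theorem 1.4) carry a factor `e^γ` in front of `e^{H_n}`; §7 (Lemma 20,
Theorem 7.1), the proof on p. 24 and Lagarias 2002 do not, and the §7 form is the one typed here.

## Sources

* S. Fan, M. Kobayashi, G. Molnar, *A family of analogues to the Robin criterion*, Ramanujan J.
  70 (2026), doi 10.1007/s11139-026-01408-3 = arXiv:2511.02106: §7 (Lemma 20, Thm. 7.1),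
  Thm. 1.4, Lemma 17. [FanKobayashiMolnar2026]
* J. C. Lagarias, *An elementary problem equivalent to the Riemann hypothesis*, Amer. Math.
  Monthly 109 (2002) 534–543: Lemmas 3.1–3.2. [Lagarias2002]
-/

open Real Filter
open scoped ArithmeticFunction.sigma

namespace Literature.NumberTheory.LFunctions

/-! ### The comparison of the two right-hand sides -/

/-- The step "`7κ/(e^γ log n log log n) < c/(log n)^b` for all `n` sufficiently large" of the
printed proof, combined with Lagarias' Lemma: for `c > 0` and `b ≤ 1`, for all sufficiently large
`n`, `H_n + e^{H_n} log H_n < e^γ n log log n · (1 + c/(log n)^b)`. (Explicit range used: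
`n ≥ 3` and `log log n > 7/(c e^γ)`.) [cite: FanKobayashiMolnar2026, §7, proof of Thm. 7.1] -/
theorem harmonic_add_exp_mul_log_lt_eventually {b c : ℝ} (hb : b ≤ 1) (hc : 0 < c) :
    ∀ᶠ n : ℕ in atTop,
      (harmonic n : ℝ) + exp (harmonic n : ℝ) * log (harmonic n : ℝ) <
        exp eulerMascheroniConstant * n * log (log n) * (1 + c / log n ^ b) := by
  set G : ℝ := exp eulerMascheroniConstant with hGdef
  have hGpos : 0 < G := exp_pos _
  have hev : ∀ᶠ n : ℕ in atTop, 3 ≤ n ∧ 7 / (c * G) < log (log n) := by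
    refine (eventually_ge_atTop 3).and ?_
    have ht : Tendsto (fun n : ℕ ↦ log (log n)) atTop atTop :=
      tendsto_log_atTop.comp (tendsto_log_atTop.comp tendsto_natCast_atTop_atTop)
    exact ht.eventually (eventually_gt_atTop (7 / (c * G)))
  filter_upwards [hev] with n hn
  obtain ⟨hn3, hLL⟩ := hn
  set L : ℝ := log n with hLdef
  have hn0 : (0 : ℝ) < n := by exact_mod_cast (show 0 < n by omega)
  have hL1 : 1 < L := one_lt_log_natCast hn3
  have hL0 : 0 < L := by linarith
  have hLL0 : 0 < log L := log_pos hL1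
  -- `(log n)^b ≤ log n`
  have hLb : L ^ b ≤ L := by
    calc L ^ b ≤ L ^ (1 : ℝ) := rpow_le_rpow_of_exponent_le hL1.le hb
      _ = L := rpow_one L
  have hLbpos : 0 < L ^ b := rpow_pos_of_pos hL0 b
  -- `7 < c e^γ log log n`
  have h7 : 7 < c * G * log L := by
    have := (div_lt_iff₀ (by positivity : 0 < c * G)).1 hLL
    linarith [this]
  -- `7 n / log n < e^γ n log log n · c / (log n)^b`
  have hkey : 7 * n / L < G * n * log L * (c / L ^ b) := by
    rw [mul_div_assoc', div_lt_div_iff₀ hL0 hLbpos]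
    have h1 : 7 * (n : ℝ) * L ^ b ≤ 7 * n * L := by nlinarith
    have hnL : 0 < (n : ℝ) * L := mul_pos hn0 hL0
    have h2 : 7 * (n : ℝ) * L < G * n * log L * c * L := by
      calc 7 * (n : ℝ) * L = 7 * (n * L) := by ring
        _ < c * G * log L * (n * L) := mul_lt_mul_of_pos_right h7 hnL
        _ = G * n * log L * c * L := by ring
    linarith
  calc (harmonic n : ℝ) + exp (harmonic n : ℝ) * log (harmonic n : ℝ)
      ≤ G * n * log L + 7 * n / L := Lagarias2002_lemma_3_2 (by omega)
    _ < G * n * log L + G * n * log L * (c / L ^ b) := by linarith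
    _ = G * n * log L * (1 + c / L ^ b) := by ring

/-- `1 ≤ H_n` for `n ≥ 3` (indeed for `n ≥ 1`; from Mathlib's `log (n+1) ≤ H_n`). [folklore] -/
private theorem one_le_harmonic_cast {n : ℕ} (hn : 3 ≤ n) : (1 : ℝ) ≤ (harmonic n : ℝ) := by
  have h1 : log ((n + 1 : ℕ) : ℝ) ≤ (harmonic n : ℝ) := log_add_one_le_harmonic n
  have h2 : 1 < log ((n + 1 : ℕ) : ℝ) := one_lt_log_natCast (by omega)
  linarith

/-- `0 ≤ e^{H_n} log H_n ≤ H_n + e^{H_n} log H_n` for `n ≥ 3`. [folklore] -/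
private theorem lagarias_rhs_bounds {n : ℕ} (hn : 3 ≤ n) :
    0 ≤ exp (harmonic n : ℝ) * log (harmonic n : ℝ) ∧
      exp (harmonic n : ℝ) * log (harmonic n : ℝ) ≤
        (harmonic n : ℝ) + exp (harmonic n : ℝ) * log (harmonic n : ℝ) := by
  have hH1 := one_le_harmonic_cast hn
  have hlogH : 0 ≤ log (harmonic n : ℝ) := log_nonneg hH1
  exact ⟨mul_nonneg (exp_pos _).le hlogH, le_add_of_nonneg_left (by linarith)⟩

/-! ### Theorem 7.1, the RH-free implications -/

/-- **Fan–Kobayashi–Molnar 2026, Theorem 7.1, (3) ⇒ (1)**, for every real `κ > 1`: if the weak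
`κ`-Lagarias inequality `σ^[κ](n) < (H_n + e^{H_n} log H_n)^κ / ζ(κ)` holds for all sufficiently
large `n`, then the Riemann hypothesis holds. (Printed for `κ ≥ 2` with the range `n > 55440`, where
the converse also holds; this direction is Robin's theorem (Theorem 5.2) plus Lagarias' Lemma and
needs only `κ > 1`.) [cite: FanKobayashiMolnar2026, Thm. 7.1] -/
theorem FanKobayashiMolnar2026_thm71_rh_of_eventually {κ : ℝ} (hκ : 1 < κ)
    (h : ∀ᶠ n : ℕ in atTop,
      sigmaLcmPow κ n <
        ((harmonic n : ℝ) + exp (harmonic n : ℝ) * log (harmonic n : ℝ)) ^ κ / zetaRealSum κ) :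
    RiemannHypothesis := by
  by_contra hRH
  obtain ⟨b, c, -, hb, hc, hall⟩ := FanKobayashiMolnar2026_thm52 hRH
  have hκ0 : 0 < κ := by linarith
  have hZ := zetaRealSum_pos hκ
  have hev := harmonic_add_exp_mul_log_lt_eventually (b := b) (c := c) (by linarith) hc
  obtain ⟨n, ⟨⟨hn1, hn2⟩, hn3⟩, hn4⟩ :=
    ((((hall κ hκ).and_eventually h).and_eventually hev).and_eventually
      (eventually_ge_atTop 3)).exists
  -- `hn1 : R^κ/ζ(κ) · W^κ < σ^[κ](n)`, `hn2 : σ^[κ](n) < A^κ/ζ(κ)`, `hn3 : A < R · W`.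
  set A : ℝ := (harmonic n : ℝ) + exp (harmonic n : ℝ) * log (harmonic n : ℝ) with hAdef
  set R : ℝ := exp eulerMascheroniConstant * n * log (log n) with hRdef
  set W : ℝ := 1 + c / log n ^ b with hWdef
  have hlog1 : 1 < log (n : ℝ) := one_lt_log_natCast hn4
  have hlog0 : 0 < log (n : ℝ) := by linarith
  have hLL : 0 < log (log (n : ℝ)) := log_pos hlog1
  have hX : 0 < log (n : ℝ) ^ b := rpow_pos_of_pos hlog0 b
  have hR0 : 0 < R := by positivity
  have hW0 : 0 < W := by have := div_pos hc hX; linarith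
  have hA0 : 0 ≤ A := by
    obtain ⟨h0, hle⟩ := lagarias_rhs_bounds hn4
    exact h0.trans hle
  have h3 : A ^ κ < (R * W) ^ κ := rpow_lt_rpow hA0 hn3 hκ0
  have h4 : (R * W) ^ κ = R ^ κ * W ^ κ := mul_rpow hR0.le hW0.le
  have h5 : A ^ κ / zetaRealSum κ < R ^ κ * W ^ κ / zetaRealSum κ := by
    rw [← h4]; exact div_lt_div_of_pos_right h3 hZ
  rw [div_mul_eq_mul_div] at hn1
  linarith

/-- **Fan–Kobayashi–Molnar 2026, Theorem 7.1, (2) ⇒ (1)**, for every real `κ > 1`: if the strong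
`κ`-Lagarias inequality `σ^[κ](n) < (e^{H_n} log H_n)^κ / ζ(κ)` holds for all sufficiently large
`n`, then RH (via (2) ⇒ (3), "immediate"). [cite: FanKobayashiMolnar2026, Thm. 7.1] -/
theorem FanKobayashiMolnar2026_thm71_rh_of_eventually_exp {κ : ℝ} (hκ : 1 < κ)
    (h : ∀ᶠ n : ℕ in atTop,
      sigmaLcmPow κ n <
        (exp (harmonic n : ℝ) * log (harmonic n : ℝ)) ^ κ / zetaRealSum κ) :
    RiemannHypothesis := by
  refine FanKobayashiMolnar2026_thm71_rh_of_eventually hκ ?_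
  have hκ0 : 0 < κ := by linarith
  have hZ := zetaRealSum_pos hκ
  filter_upwards [h, eventually_ge_atTop 3] with n hn hn3
  obtain ⟨h0, hle⟩ := lagarias_rhs_bounds hn3
  exact hn.trans_le (div_le_div_of_nonneg_right (rpow_le_rpow h0 hle hκ0.le) hZ.le)

/-- Theorem 7.1, (3) ⇒ (1), threshold form: if for some `n₀` (the paper: `n₀ = 55440` for
`κ ≥ 2`; `n₀ = 1` for `κ ≥ 4`, Theorem 1.4) `σ^[κ](n) < (H_n + e^{H_n} log H_n)^κ / ζ(κ)` for every
`n > n₀`, then RH (`κ > 1` real). [cite: FanKobayashiMolnar2026, Thm. 7.1 / Thm. 1.4] -/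
theorem FanKobayashiMolnar2026_thm71_rh_of_forall_gt {κ : ℝ} (hκ : 1 < κ) (n₀ : ℕ)
    (h : ∀ n : ℕ, n₀ < n →
      sigmaLcmPow κ n <
        ((harmonic n : ℝ) + exp (harmonic n : ℝ) * log (harmonic n : ℝ)) ^ κ / zetaRealSum κ) :
    RiemannHypothesis :=
  FanKobayashiMolnar2026_thm71_rh_of_eventually hκ ((eventually_gt_atTop n₀).mono h)

/-- Theorem 7.1, (2) ⇒ (1), threshold form (`n₀ = 55440` in print). [cite: FanKobayashiMolnar2026,
Thm. 7.1] -/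
theorem FanKobayashiMolnar2026_thm71_rh_of_forall_gt_exp {κ : ℝ} (hκ : 1 < κ) (n₀ : ℕ)
    (h : ∀ n : ℕ, n₀ < n →
      sigmaLcmPow κ n < (exp (harmonic n : ℝ) * log (harmonic n : ℝ)) ^ κ / zetaRealSum κ) :
    RiemannHypothesis :=
  FanKobayashiMolnar2026_thm71_rh_of_eventually_exp hκ ((eventually_gt_atTop n₀).mono h)

/-! ### Nesting: `κ`-Lagarias at `n` implies Lagarias at `n` -/

/-- At any `n ≥ 3`, the `κ`-Lagarias inequality `σ^[κ](n) < (H_n + e^{H_n} log H_n)^κ / ζ(κ)`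
implies Lagarias's inequality `σ(n) < H_n + e^{H_n} log H_n` (`κ > 1`), by Lemma 17's
`σ(n)^κ ≤ ζ(κ) σ^[κ](n)` — "counterexamples accrue as `κ` shrinks", as for Robin's inequality
(`robinInequality_of_sigmaLcmPow_lt`). [cite: FanKobayashiMolnar2026, Lemma 17 / §7] -/
theorem lagariasInequality_of_sigmaLcmPow_lt {κ : ℝ} (hκ : 1 < κ) {n : ℕ} (hn : 3 ≤ n)
    (h : sigmaLcmPow κ n <
      ((harmonic n : ℝ) + exp (harmonic n : ℝ) * log (harmonic n : ℝ)) ^ κ / zetaRealSum κ) :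
    (σ 1 n : ℝ) < (harmonic n : ℝ) + exp (harmonic n : ℝ) * log (harmonic n : ℝ) := by
  have hκ0 : 0 < κ := by linarith
  have hZ := zetaRealSum_pos hκ
  have hA0 : 0 ≤ (harmonic n : ℝ) + exp (harmonic n : ℝ) * log (harmonic n : ℝ) := by
    obtain ⟨h0, hle⟩ := lagarias_rhs_bounds hn
    exact h0.trans hle
  have h1 := sigma_rpow_le_zetaRealSum_mul_sigmaLcmPow hκ n
  rw [lt_div_iff₀ hZ] at h
  have h2 : (σ 1 n : ℝ) ^ κ <
      ((harmonic n : ℝ) + exp (harmonic n : ℝ) * log (harmonic n : ℝ)) ^ κ := by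
    nlinarith [mul_comm (zetaRealSum κ) (sigmaLcmPow κ n)]
  exact (rpow_lt_rpow_iff (Nat.cast_nonneg _) hA0 hκ0).1 h2

end Literature.NumberTheory.LFunctions
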